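import Summits.CriticalPhenomena.Ising3D.TaylorKernelPDDelta
import Mathlib.Tactic.Linarith
import Mathlib.Tactic.Positivity
import Mathlib.Tactic.Ring
import HarnessLib

/-!
# δ-expanded kernel tables with a SIGNED second-order slot (`deltaT2S`)
(cell `pub-ising3x`, seat boot-1 gen 16; the literal-table lever behind the odd head layer's box-size reach)

HONEST FRAMING: lottery ticket; floor = tightest certified 3D Ising CFT bounds; no exact-solution
claim without a proof. Island framing: certified exclusion region at stated derivative order and
assumptions; not a determination of the 3D Ising critical exponents beyond that.

`TaylorKernelPDDelta.deltaT2` encloses the order-`≥ 2` part of the `δ`-expansion of the kernel with the SYMMETRIC factor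
remainders `sigmaRemB = [−b, b]` (`TaylorSigmaDelta`), so its entries are centred near `K(C₁,C₁)` with radius `≈ 2|c₂ C₀|`:
the true second-order coefficient sits inside the radius, unsigned. This file keeps the second order EXACT and signs it:
each factor splits one order further, `σ_i(s₀+δ) = c₀ + δ c₁ + δ² (c₂ + δ ρ₃(δ))`, `|ρ₃| ≤ b₃ = absBound_W(coeffs ≥ 3)`
(`sigmaC2`, `sigmaRemB3`, `sigma_eq_split3`, `mem_sigmaRemB3`), and the slot becomes
`T₂ˢ = [K(C₁,C₁) + K(C₀,C₂) + K(C₂,C₀)] + [−W,W]·(K(C₁,C₂)+K(C₂,C₁)+K(C₀,B₃)+K(B₃,C₀)) + [0,W²]·(K(C₂,C₂)+K(C₁,B₃)+K(B₃,C₁))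
 + [−W³,W³]·(K(C₂,B₃)+K(B₃,C₂)) + [0,W⁴]·K(B₃,B₃)` (`deltaT2S`), with real shadow `deltaT2SR δ` and the two facts every consumer
needs, in the SAME shape as `pmem2_deltaT2` / `evenKernel_eq_eval2_delta`:
* `pmem2_deltaT2S` — `|δ| ≤ W ⇒ PMem2 S (deltaT2SR … δ) (deltaT2S … W …)`;
* `evenKernel_eq_eval2_deltaS` — `K_c[s₀+δ](u,v) = eval2 T₀ᴿ + δ·eval2 T₁ᴿ + δ²·eval2 T₂ˢᴿ(δ)`.
The TRIPLE format of the literal δ-tables and its semantics are unchanged (slot 2 still absorbs every order ≥ 2); only the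
enclosure is tighter (measured on the cell's odd-head twins: remainder budgets ÷ 50 at box half-width 2.4e-4). No new mathematics. [folklore]
-/

namespace Summit.CriticalPhenomena.Ising3D

open Finset
open Literature.Analysis.ValidatedNumerics Literature.Analysis.ValidatedNumerics.PolyMP
open Literature.Analysis.ValidatedNumerics.NumericsMP (MI)
open Literature.MathematicalPhysics.QuantumFieldTheory.ConformalBootstrap3D

/-! ### One more order in the factor split (`TaylorSigmaDelta` level) -/

/-- Order-2 coefficient `c₂` of `δ ↦ (-1)^i C(s₀ + δ, i)` as a (thin) interval at scale `S`. [folklore] -/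
def sigmaC2 (S : ℕ) (s₀ : ℚ) (i : ℕ) : MI := PolyMP.ofRat S ((sigmaDeltaQ s₀ i).getD 2 0)

/-- The scaled bound of the THIRD-order tail for `|δ| ≤ W`: `absBound` of the coefficients of order `≥ 3`. [folklore] -/
def sigmaRemBound3 (S : ℕ) (s₀ W : ℚ) (i : ℕ) : ℤ :=
  absBoundI S W.num W.den (ofRatList S ((sigmaDeltaQ s₀ i).drop 3))

/-- The third-order tail interval `[-b₃, b₃]`. [folklore] -/
def sigmaRemB3 (S : ℕ) (s₀ W : ℚ) (i : ℕ) : MI := ⟨-sigmaRemBound3 S s₀ W i, sigmaRemBound3 S s₀ W i⟩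

/-- The real third-order tail function `ρ₃,ᵢ(δ)`. [folklore] -/
noncomputable def sigmaRho3 (s₀ : ℚ) (i : ℕ) (δ : ℝ) : ℝ := evalR (((sigmaDeltaQ s₀ i).drop 3).map ((↑) : ℚ → ℝ)) δ

/-- The real order-2 coefficient. [folklore] -/
noncomputable def sigC2 (s₀ : ℚ) (i : ℕ) : ℝ := (((sigmaDeltaQ s₀ i).getD 2 0 : ℚ) : ℝ)

/-- Horner split after one coefficient. [folklore] -/
theorem evalR_split1 (L : List ℝ) (δ : ℝ) : evalR L δ = L.getD 0 0 + δ * evalR (L.drop 1) δ := by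
  match L with
  | [] => simp
  | a :: t => simp only [evalR_cons, List.getD_cons_zero, List.drop_succ_cons, List.drop_zero]

/-- **The second-order remainder splits once more**: `ρ_i(δ) = c₂ + δ · ρ₃,ᵢ(δ)`. [folklore] -/
theorem sigmaRho_eq_split3 (s₀ : ℚ) (i : ℕ) (δ : ℝ) : sigmaRho s₀ i δ = sigC2 s₀ i + δ * sigmaRho3 s₀ i δ := by
  rw [sigmaRho, evalR_split1, sigmaRho3, sigC2]
  have h1 : (((sigmaDeltaQ s₀ i).drop 2).map ((↑) : ℚ → ℝ)).getD 0 0 = (((sigmaDeltaQ s₀ i).getD 2 0 : ℚ) : ℝ) := by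
    rw [getD_map_cast]; simp [List.getD_eq_getElem?_getD, List.getElem?_drop]
  have h2 : (((sigmaDeltaQ s₀ i).drop 2).map ((↑) : ℚ → ℝ)).drop 1 = ((sigmaDeltaQ s₀ i).drop 3).map ((↑) : ℚ → ℝ) := by
    rw [← List.map_drop, List.drop_drop]
  rw [h1, h2]

/-- [folklore] -/
theorem mem_sigmaC2 (S : ℕ) (s₀ : ℚ) (i : ℕ) : MI.mem S (sigC2 s₀ i) (sigmaC2 S s₀ i) := mem_ofRat S _

/-- **The third-order tail lies in `[-b₃, b₃]`** for `|δ| ≤ W` (`W ≥ 0`). [folklore] -/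
theorem mem_sigmaRemB3 (S : ℕ) (s₀ : ℚ) {W : ℚ} (hW : 0 ≤ W) (i : ℕ) {δ : ℝ} (hδ : |δ| ≤ W) :
    MI.mem S (sigmaRho3 s₀ i δ) (sigmaRemB3 S s₀ W i) := by
  have hWn : 0 ≤ W.num := Rat.num_nonneg.mpr hW
  have hpm := pmem_ofRatList S ((sigmaDeltaQ s₀ i).drop 3)
  have h1 : |sigmaRho3 s₀ i δ| ≤ absBoundR (((sigmaDeltaQ s₀ i).drop 3).map ((↑) : ℚ → ℝ)) ((W.num : ℝ) / W.den) := by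
    refine abs_evalR_le_absBoundR _ (hδ.trans (le_of_eq ?_))
    exact ratCast_eq_num_div_den W
  have h2 := absBoundR_le_absBoundI hWn W.den_pos hpm
  have hS0 : (0 : ℝ) ≤ S := by exact_mod_cast Nat.zero_le S
  have h3 : |sigmaRho3 s₀ i δ| * S ≤ (sigmaRemBound3 S s₀ W i : ℝ) := by
    rw [sigmaRemBound3]
    exact (mul_le_mul_of_nonneg_right h1 hS0).trans h2
  rw [sigmaRemB3, MI.mem]
  push_cast
  constructor
  · nlinarith [neg_abs_le (sigmaRho3 s₀ i δ), abs_nonneg (sigmaRho3 s₀ i δ)]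
  · nlinarith [le_abs_self (sigmaRho3 s₀ i δ)]

/-- **The factor split to third order**: `(-1)^i C(s₀ + δ, i) = c₀ + δ c₁ + δ² (c₂ + δ ρ₃,ᵢ(δ))`. [folklore] -/
theorem sigma_eq_split3 (s₀ : ℚ) (i : ℕ) (δ : ℝ) :
    (-1) ^ i * Ring.choose ((s₀ : ℝ) + δ) i = sigC0 s₀ i + δ * sigC1 s₀ i + δ ^ 2 * (sigC2 s₀ i + δ * sigmaRho3 s₀ i δ) := by
  rw [sigma_eq_split, sigmaRho_eq_split3, sigC0, sigC1]

/-! ### The kernel's δ-expansion with four coefficient functions -/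

/-- [folklore] -/
theorem qFactorG_delta3 {σ C0 C1 C2 ρ : ℕ → ℝ} {δ : ℝ} (h : ∀ i, σ i = C0 i + δ * C1 i + δ ^ 2 * (C2 i + δ * ρ i))
    (x : ℝ) (a : ℕ) :
    qFactorG σ x a = qFactorG C0 x a + δ * qFactorG C1 x a + δ ^ 2 * (qFactorG C2 x a + δ * qFactorG ρ x a) := by
  simp only [qFactorG, h, add_mul, sum_add_distrib, mul_assoc, mul_sum, mul_add]

/-- [folklore] -/
theorem termG_delta3 {σ C0 C1 C2 ρ : ℕ → ℝ} {δ : ℝ} (h : ∀ i, σ i = C0 i + δ * C1 i + δ ^ 2 * (C2 i + δ * ρ i))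
    (c : ℕ × ℕ → ℝ) (sg u v : ℝ) (ab : ℕ × ℕ) :
    termG c σ σ sg u v ab = termG c C0 C0 sg u v ab + δ * (termG c C1 C0 sg u v ab + termG c C0 C1 sg u v ab) +
      δ ^ 2 * ((termG c C1 C1 sg u v ab + termG c C0 C2 sg u v ab + termG c C2 C0 sg u v ab) +
        δ * (termG c C1 C2 sg u v ab + termG c C2 C1 sg u v ab + termG c C0 ρ sg u v ab + termG c ρ C0 sg u v ab) +
        δ ^ 2 * (termG c C2 C2 sg u v ab + termG c C1 ρ sg u v ab + termG c ρ C1 sg u v ab) +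
        δ ^ 3 * (termG c C2 ρ sg u v ab + termG c ρ C2 sg u v ab) + δ ^ 4 * termG c ρ ρ sg u v ab) := by
  simp only [termG, qFactorG_delta3 h]
  ring

/-- **δ-expansion of the kernel with the signed second order.** [folklore] -/
theorem evenKernelG_delta3 {σ C0 C1 C2 ρ : ℕ → ℝ} {δ : ℝ} (h : ∀ i, σ i = C0 i + δ * C1 i + δ ^ 2 * (C2 i + δ * ρ i))
    (c : ℕ × ℕ → ℝ) (S : Finset (ℕ × ℕ)) (sg u v : ℝ) :
    evenKernelG c S σ σ sg u v =
      evenKernelG c S C0 C0 sg u v + δ * (evenKernelG c S C1 C0 sg u v + evenKernelG c S C0 C1 sg u v) +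
        δ ^ 2 * ((evenKernelG c S C1 C1 sg u v + evenKernelG c S C0 C2 sg u v + evenKernelG c S C2 C0 sg u v) +
          δ * (evenKernelG c S C1 C2 sg u v + evenKernelG c S C2 C1 sg u v + evenKernelG c S C0 ρ sg u v +
            evenKernelG c S ρ C0 sg u v) +
          δ ^ 2 * (evenKernelG c S C2 C2 sg u v + evenKernelG c S C1 ρ sg u v + evenKernelG c S ρ C1 sg u v) +
          δ ^ 3 * (evenKernelG c S C2 ρ sg u v + evenKernelG c S ρ C2 sg u v) + δ ^ 4 * evenKernelG c S ρ ρ sg u v) := by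
  unfold evenKernelG
  rw [sum_congr rfl fun ab _ => termG_delta3 h c sg u v ab]
  simp only [sum_add_distrib, ← mul_sum]

/-! ### The signed second-order table, its real shadow, soundness -/

/-- **Second-order table with the SIGNED exact part** and the `δ`-weighted third/fourth-order tails, valid for every `|δ| ≤ W`. [folklore] -/
def deltaT2S (S : ℕ) (cQ : ℕ × ℕ → ℚ) (σQ : ℚ) (s₀ W ccQ : ℚ) (l : List (ℕ × ℕ)) : IPoly2 :=
  let C0 := sigmaC0 S s₀
  let C1 := sigmaC1 S s₀
  let C2 := sigmaC2 S s₀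
  let B3 := sigmaRemB3 S s₀ W
  let K := fun A B => kernelPDLI2 S cQ σQ A B ccQ l
  add2I (add2I (K C1 C1) (add2I (K C0 C2) (K C2 C0)))
    (add2I (smul2MI S (enclQ S (-W) W) (add2I (add2I (K C1 C2) (K C2 C1)) (add2I (K C0 B3) (K B3 C0))))
      (add2I (smul2MI S (enclQ S 0 (W ^ 2)) (add2I (K C2 C2) (add2I (K C1 B3) (K B3 C1))))
        (add2I (smul2MI S (enclQ S (-(W ^ 3)) (W ^ 3)) (add2I (K C2 B3) (K B3 C2)))
          (smul2MI S (enclQ S 0 (W ^ 4)) (K B3 B3)))))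

/-- Real shadow of `deltaT2S` at a given `δ`. [folklore] -/
noncomputable def deltaT2SR (cQ : ℕ × ℕ → ℚ) (σQ : ℚ) (s₀ ccQ : ℚ) (l : List (ℕ × ℕ)) (δ : ℝ) : List (List ℝ) :=
  let c : ℕ × ℕ → ℝ := fun ab => (cQ ab : ℝ)
  let K := fun A B => kernelPDLG c l A B (σQ : ℝ) (ccQ : ℝ)
  let C0 := sigC0 s₀
  let C1 := sigC1 s₀
  let C2 := sigC2 s₀
  let R3 := fun i => sigmaRho3 s₀ i δ
  add2 (add2 (K C1 C1) (add2 (K C0 C2) (K C2 C0)))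
    (add2 (smul2 δ (add2 (add2 (K C1 C2) (K C2 C1)) (add2 (K C0 R3) (K R3 C0))))
      (add2 (smul2 (δ ^ 2) (add2 (K C2 C2) (add2 (K C1 R3) (K R3 C1))))
        (add2 (smul2 (δ ^ 3) (add2 (K C2 R3) (K R3 C2)))
          (smul2 (δ ^ 4) (K R3 R3)))))

/-- **Soundness of the signed table**: for `|δ| ≤ W` the real shadow lies in `deltaT2S`. [folklore] -/
theorem pmem2_deltaT2S {S : ℕ} (hS : 0 < S) (cQ : ℕ × ℕ → ℚ) (σQ : ℚ) (s₀ : ℚ) {W : ℚ} (hW : 0 ≤ W) (ccQ : ℚ)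
    (l : List (ℕ × ℕ)) {δ : ℝ} (hδ : |δ| ≤ W) :
    PMem2 S (deltaT2SR cQ σQ s₀ ccQ l δ) (deltaT2S S cQ σQ s₀ W ccQ l) := by
  have hρ : ∀ i, MI.mem S (sigmaRho3 s₀ i δ) (sigmaRemB3 S s₀ W i) := fun i => mem_sigmaRemB3 S s₀ hW i hδ
  have h0 := mem_sigmaC0 S s₀
  have h1 := mem_sigmaC1 S s₀
  have h2 : ∀ i, MI.mem S (sigC2 s₀ i) (sigmaC2 S s₀ i) := mem_sigmaC2 S s₀
  have hWr : (0 : ℝ) ≤ W := by exact_mod_cast hW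
  have hδW : -(W : ℝ) ≤ δ ∧ δ ≤ W := ⟨by linarith [neg_abs_le δ, hδ], by linarith [le_abs_self δ, hδ]⟩
  have hδI : MI.mem S δ (enclQ S (-W) W) := mem_enclQ S (by push_cast; exact hδW.1) (by exact_mod_cast hδW.2)
  have hsq : δ ^ 2 ≤ (W : ℝ) ^ 2 := by rw [← sq_abs]; exact pow_le_pow_left₀ (abs_nonneg δ) hδ 2
  have hδ2 : MI.mem S (δ ^ 2) (enclQ S 0 (W ^ 2)) := mem_enclQ S (by push_cast; positivity) (by exact_mod_cast hsq)
  have hcube : |δ ^ 3| ≤ (W : ℝ) ^ 3 := by rw [abs_pow]; exact pow_le_pow_left₀ (abs_nonneg δ) hδ 3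
  have hδ3 : MI.mem S (δ ^ 3) (enclQ S (-(W ^ 3)) (W ^ 3)) :=
    mem_enclQ S (by push_cast; linarith [neg_abs_le (δ ^ 3), hcube]) (by push_cast; linarith [le_abs_self (δ ^ 3), hcube])
  have h4 : δ ^ 4 ≤ (W : ℝ) ^ 4 := by
    have : δ ^ 4 = (δ ^ 2) ^ 2 := by ring
    rw [this, show (W : ℝ) ^ 4 = ((W : ℝ) ^ 2) ^ 2 by ring]
    exact pow_le_pow_left₀ (by positivity) hsq 2
  have hδ4 : MI.mem S (δ ^ 4) (enclQ S 0 (W ^ 4)) := mem_enclQ S (by push_cast; positivity) (by exact_mod_cast h4)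
  have K := fun {σ₁ σ₂ : ℕ → ℝ} {C₁ C₂ : ℕ → MI} (ha : ∀ i, MI.mem S (σ₁ i) (C₁ i)) (hb : ∀ i, MI.mem S (σ₂ i) (C₂ i)) =>
    pmem2_kernelPDLI2 hS cQ σQ ccQ l ha hb
  unfold deltaT2SR deltaT2S
  exact pmem2_add2I (pmem2_add2I (K h1 h1) (pmem2_add2I (K h0 h2) (K h2 h0)))
    (pmem2_add2I (pmem2_smul2MI hS hδI (pmem2_add2I (pmem2_add2I (K h1 h2) (K h2 h1)) (pmem2_add2I (K h0 hρ) (K hρ h0))))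
      (pmem2_add2I (pmem2_smul2MI hS hδ2 (pmem2_add2I (K h2 h2) (pmem2_add2I (K h1 hρ) (K hρ h1))))
        (pmem2_add2I (pmem2_smul2MI hS hδ3 (pmem2_add2I (K h2 hρ) (K hρ h2)))
          (pmem2_smul2MI hS hδ4 (K hρ hρ)))))

/-- **The δ-expanded kernel through the tables with the signed slot**: for `s = s₀ + δ` and duplicate-free `l`,
`K_c[s](u,v) = eval2 T₀ᴿ + δ · eval2 T₁ᴿ + δ² · eval2 T₂ˢᴿ(δ)` at `(u+v−cc, u−v)`. [folklore] -/
theorem evenKernel_eq_eval2_deltaS (cQ : ℕ × ℕ → ℚ) (σQ : ℚ) (s₀ ccQ : ℚ) {l : List (ℕ × ℕ)} (hl : l.Nodup)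
    (δ u v : ℝ) :
    evenKernel (fun ab => (cQ ab : ℝ)) l.toFinset ((s₀ : ℝ) + δ) (σQ : ℝ) u v =
      eval2 (deltaT0R cQ σQ s₀ ccQ l) (u + v - ccQ) (u - v) +
        δ * eval2 (deltaT1R cQ σQ s₀ ccQ l) (u + v - ccQ) (u - v) +
          δ ^ 2 * eval2 (deltaT2SR cQ σQ s₀ ccQ l δ) (u + v - ccQ) (u - v) := by
  have hsplit : ∀ i, (-1) ^ i * Ring.choose ((s₀ : ℝ) + δ) i =
      sigC0 s₀ i + δ * sigC1 s₀ i + δ ^ 2 * (sigC2 s₀ i + δ * sigmaRho3 s₀ i δ) := fun i => sigma_eq_split3 s₀ i δ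
  rw [evenKernel_eq_evenKernelG, evenKernelG_delta3 hsplit]
  simp only [deltaT0R, deltaT1R, deltaT2SR, eval2_add2, eval2_smul2, eval2_kernelPDLG _ hl]
  ring

end Summit.CriticalPhenomena.Ising3D
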